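import Summits.AtomisticToContinuum.BoseEinsteinCondensation.Theses.BECStronglyRayleigh
import Summits.AtomisticToContinuum.BoseEinsteinCondensation.Theses.BECLiebAntibunching

/-!
# Route `BECStronglyRayleigh`, crux `LatticeToPeriodicBridge` (stmt-AtomisticToContinuum-9674),
# line `muffin-tin-reward-supermodularity` — vocabulary and registered stub statements

This is the `Defs` module of the crux line `muffin-tin-reward-supermodularity`
(`Summits/AtomisticToContinuum/BoseEinsteinCondensation/Cruxes/LatticeToPeriodicBridge/Lines/muffin-tin-reward-supermodularity.{md,lean}`,
idea card `…/Ideas/muffin-tin-reward-supermodularity.md`, crux-ideate r1 ideator 3; triage r1-1/2/3: pass; planner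
`planner-cruxplan-…-muffin-tin-reward-su-0`; lead's reshape 2026-08-16, lead prover-line-stmt-AtomisticToContinuum-9674-1).
It holds, verbatim from the planner's skeleton and in the skeleton's namespace — so that the registered stub signatures
`Sig.stub_<name>` resolve BY NAME in the stub files `Theorems/BECStronglyRayleighLatticeToPeriodicBridgeMuffinTin<Stub>.lean`
(landed `--supports stmt-AtomisticToContinuum-9674`):

* the OBJECTS the line posits at fixed `(N, L)` (plain data over tree vocabulary, no `Prop` hidden in a definition):
  the thick muffin-tin wall count `wallCount` (slab-sum form, period `b = L/M`, relative wall thickness `w`), its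
  expectation `wallEnergy`, the two-coupling functional / energy `twoCouplingFunctional`, `twoCouplingEnergy`
  (`E_v[Ψ] + λ⟨W⟩_Ψ + κ(N − n₀Ψ)` and its infimum), the UPPER ground-state constant-mode occupation `upperCondensate`
  (`n₀⁺(λ,κ) = ⨅_{δ>0} ⨆ {n₀Ψ : Ψ δ-near-minimiser}`), the deep-wall share `deepShare w = ((8/π²)(1−w))³`, and on the
  lattice side `occInd`, the coherence sum `cohSum ψ N = Σ_{|T|=N−1} ‖Σ_{x∉T} ψ(1_{T∪{x}})‖² (= ⟨ψ, S⁺_totS⁻_totψ⟩)`,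
  the antecedent's bracket `latticeBracket M N` (VERBATIM the right-hand side of `KineticLatticeBEC` at lattice size `M`)
  and the sector-ground-vector predicate `IsSectorGround`;
* the STATEMENTS of the line: the planner's four (`WallsOnlyDeplete` = LDM₀ for `n₀⁺`, `DeepWallBand`, `LatticeReadout`,
  `FreeEndRigidity`) and the planner's two typed tools (`RewardWallGerm`, `MaxwellDanskin`), as named, deliberately
  untagged `Prop`s — intermediate statements of a proof plan, not results in print (the audit's advisory `vendored-fact`
  class for witness-less `def : Prop` is expected until the stub files provide the witnesses);
* the REGISTERED STUB SIGNATURES `Sig.stub_*` of the lead's skeleton v2 (five stubs): the lead (i) RESHAPES S4 to take the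
  sub-problem's fixed-`N` route item `PeriodicRigidity` (stmt-AtomisticToContinuum-9467, namespace `BECLiebAntibunching`,
  weakest typed form `∀η ∀ᶠN ∃δ`) BY NAME as antecedent — exactly as line `coarse-cell-lorentzian` reshaped its S6
  (`CoarseCellLorentzian.Sig.stub_positiveTransfer`); the occupation-stability input (stmt-9164) is NOT taken, it is the
  Literature theorem behind `CoarseCellLorentzian.PositiveTransfer.condensateOccupation_le_add_of_unit_mul_lintegral_le`;
  and (ii) SPLITS S1 into the open sign in its energy form, `Sig.stub_rewardWallGerm := RewardWallGerm` (the `κ = 0⁺` germ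
  of supermodularity of `E(λ,κ)`, ED-attackable at finite size), and the provable-now variational lemma
  `Sig.stub_maxwellDanskin := MaxwellDanskin`, glued back to `WallsOnlyDeplete` by the proved `wallsOnlyDeplete_of_germ`;
* small proved sanity lemmas (`wallCount_le`, `wallEnergy_le`, the `λ = κ = 0` unfoldings).

The sorry-free composition `LatticeToPeriodicBridge_of` (five stubs + `SectorGroundStatePerron` (9677), `PenaltySelectsSector`
(9678), `PeriodicRigidity` (9467) by name ⇒ the crux by name) stays in the skeleton `Lines/muffin-tin-reward-supermodularity.lean`
until the last stub lands. References: LSSY 2005 §1.2, App. D (D.15)–(D.18); Fournais 2020 (1.1)–(1.5); Tasaki 2020 §2.1;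
Danskin 1967 / Topkis 1978 (envelope theorem, supermodularity — language only); Helffer–Sjöstrand 1984, Rougerie–Spehner 2018
(strong confinement; for S2's size estimate only).
-/

noncomputable section

namespace Summit.AtomisticToContinuum.BoseEinsteinCondensation.Cruxes.LatticeToPeriodicBridge.MuffinTinRewardSupermodularity

open MeasureTheory Filter
open scoped ENNReal NNReal BigOperators Topology
open Literature.MathematicalPhysics.QuantumManyBody.BoseGas
open Literature.MathematicalPhysics.QuantumLattice
open Literature.Probability.LatticeModels (TorusSite)
open Summit.AtomisticToContinuum.BoseEinsteinCondensation.Theses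
open Summit.AtomisticToContinuum.BoseEinsteinCondensation.Theses.BECStronglyRayleigh

/-! ## Objects — the thick muffin tin and the two-coupling family at fixed `(N, L)` -/

/-- The muffin-tin WALL COUNT of a configuration (slab-sum form, triage r1-2 (3)): the number of pairs
(particle `i`, axis `k`) whose coordinate lies in a wall slab, `fract(M·x_{i,k}/L) < w`. Period `b = L/M`,
relative wall thickness `w ∈ (0,1)`; the wells are the cubes `{fract(M x_k/L) ≥ w ∀k}` of side `ℓ = (1-w)L/M`.
Bounded by `3N` (`wallCount_le`). [folklore] -/
def wallCount {N : ℕ} (M : ℕ) (L w : ℝ) (X : Config N) : ℝ≥0∞ :=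
  ∑ i : Fin N, ∑ k : Fin 3, if Int.fract ((M : ℝ) * X i k / L) < w then 1 else 0

/-- The wall energy `⟨Ψ, W Ψ⟩ = ∫_{cell^N} W(X) |Ψ(X)|² dX` of a wave function on the torus of side `L`. [folklore] -/
def wallEnergy (N : ℕ) (L : ℝ) (M : ℕ) (w : ℝ) (Ψ : Config N → ℂ) : ℝ≥0∞ :=
  ∫⁻ X in cellN N L, wallCount M L w X * ((‖Ψ X‖₊ : ℝ≥0∞)) ^ 2

/-- The TWO-COUPLING functional `⟨Ψ, (H + λW + κ(N - n̂₀)) Ψ⟩ = E_v[Ψ] + λ·⟨W⟩_Ψ + κ·(N - n₀(Ψ))` (the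
constant-mode reward written as the modular penalty `κ(N - n̂₀)`, so everything stays in `ℝ≥0∞`; supermodularity
and all derivatives in `κ` are unchanged). [folklore] -/
def twoCouplingFunctional {N : ℕ} {L : ℝ} (v : ℝ → ℝ≥0∞) (M : ℕ) (w lam kap : ℝ)
    (Ψ : PeriodicTrialState N L) : ℝ≥0∞ :=
  periodicEnergy v Ψ + ENNReal.ofReal lam * wallEnergy N L M w Ψ.ψ +
    ENNReal.ofReal kap * ((N : ℝ≥0∞) - condensateOccupation N L Ψ.ψ)

/-- The two-coupling ground-state energy `E_{N,L}(λ,κ) = inf_Ψ ⟨Ψ, (H + λW + κ(N - n̂₀)) Ψ⟩` (jointly concave in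
`(λ, κ)` as an infimum of affine functions). [folklore] -/
def twoCouplingEnergy (v : ℝ → ℝ≥0∞) (N : ℕ) (L : ℝ) (M : ℕ) (w lam kap : ℝ) : ℝ≥0∞ :=
  ⨅ Ψ : PeriodicTrialState N L, twoCouplingFunctional v M w lam kap Ψ

/-- The UPPER ground-state constant-mode occupation `n₀⁺(λ,κ) = inf_{δ>0} sup {n₀(Ψ) : Ψ δ-near-minimiser}`:
the largest constant-mode occupation among asymptotic ground states of `H + λW + κ(N - n̂₀)` (equal to the
ground state's `n₀` when the ground state is unique with a gap; `N - n₀⁺(λ,κ)` is the RIGHT derivative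
`∂⁺_κ E(λ,κ)` of the concave `E(λ,·)`, by Danskin — see `MaxwellDanskin`). [folklore] -/
def upperCondensate (v : ℝ → ℝ≥0∞) (N : ℕ) (L : ℝ) (M : ℕ) (w lam kap : ℝ) : ℝ≥0∞ :=
  ⨅ (δ : ℝ≥0∞) (_ : 0 < δ),
    ⨆ (Ψ : PeriodicTrialState N L)
      (_ : twoCouplingFunctional v M w lam kap Ψ ≤ twoCouplingEnergy v N L M w lam kap + δ),
      condensateOccupation N L Ψ.ψ

/-- The deep-wall constant-mode SHARE `z_w = ((8/π²)(1-w))³`: `M³·|⟨φ₀, u_m⟩|²` for the Dirichlet sine product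
`u_m` of one well of side `ℓ = (1-w)L/M` (`(∫₀^ℓ √(2/ℓ) sin(πt/ℓ) dt)² / (L/M) = (8/π²)(ℓ M/L)` per axis). [folklore] -/
def deepShare (w : ℝ) : ℝ :=
  (8 / Real.pi ^ 2 * (1 - w)) ^ 3

/-- Occupation indicator of a finite set of torus sites as a spin configuration (occupied = up = `Fin`-index `0`,
the convention of the antecedent and of `GroundStateStability`). [folklore] -/
def occInd {M : ℕ} (S : Finset (TorusSite 3 M)) : TensorIndex (TorusSite 3 M) 2 :=
  fun y => if y ∈ S then 0 else 1

/-- The lattice COHERENCE SUM `cohSum ψ N = Σ_{|T| = N-1} |Σ_{x ∉ T} ψ(1_{T ∪ {x}})|²` of a spin-½ vector on the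
torus `(ℤ/M)³`: for `ψ` in the sector of `N` up spins this is `‖S⁻_tot ψ‖² = ⟨ψ, S⁺_tot S⁻_tot ψ⟩ = M³·n_{k=0}`
(`(S⁻_tot ψ)(1_T) = Σ_{x∉T} ψ(1_{T∪{x}})`, spin-½ matrix elements of `S⁻_x` are `1`). [folklore] -/
def cohSum {M : ℕ} [NeZero M] (ψ : TensorIndex (TorusSite 3 M) 2 → ℂ) (N : ℕ) : ℝ :=
  ∑ T ∈ (Finset.univ : Finset (TorusSite 3 M)).powersetCard (N - 1),
    ‖∑ x ∈ Finset.univ \ T, ψ (occInd (insert x T))‖ ^ 2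

/-- The antecedent's bracket at lattice size `M` and particle number `N`: the tracial ground-state expectation of
`(Sˣ_tot)² + (Sʸ_tot)²` in the penalised XY Hamiltonian `xyTorus 3 M 1 + 4M³(Sᶻ_tot + M³/2 - N)²`, plus `N - M³/2`
— VERBATIM the right-hand side of `KineticLatticeBEC` (= `⟨S⁺_tot S⁻_tot⟩` of the sector-`N` ground state). [folklore] -/
def latticeBracket (M : ℕ) [NeZero M] (N : ℕ) : ℝ :=
  ((xyTorus 3 M 1 + (((3 + 1) * M ^ 3 : ℕ) : ℂ) • (totalSpin 1 2 + ((M : ℂ) ^ 3 / 2 - (N : ℂ)) • 1) ^ 2).groundStateFunctional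
      (totalSpin 1 0 * totalSpin 1 0 + totalSpin 1 1 * totalSpin 1 1)).re + N - (M : ℝ) ^ 3 / 2

/-- A normalised ground vector of the hard-core hopping model `xyTorus 3 M 1` in the sector of `N` particles
(`Sᶻ_tot = N - M³/2`), written with the clauses of `SectorGroundStatePerron`. [folklore] -/
def IsSectorGround (M : ℕ) [NeZero M] (N : ℕ) (ψ : TensorIndex (TorusSite 3 M) 2 → ℂ) : Prop :=
  ψ ∈ spinZSector 1 ((N : ℝ) - (M : ℝ) ^ 3 / 2) ∧
    (xyTorus 3 M 1).mulVec ψ = ((lowestEnergyInSector 1 (xyTorus 3 M 1) ((N : ℝ) - (M : ℝ) ^ 3 / 2) : ℝ) : ℂ) • ψ ∧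
    ∑ σ, ‖ψ σ‖ ^ 2 = 1

/-! ## The line's statements (planner's four stubs and two typed tools; deliberately untagged `Prop`s) -/

/-- **S1 — walls only deplete (LDM₀, upper-occupation endpoint form; the SIGN, hardest).** For every admissible `v`
and wall fraction `w ∈ (0,1)` there are a thick-wall threshold `b₁` and a density cap `ρ₁` such that on every torus
`L ≥ b₁ M` carrying the `M`-periodic muffin tin (`M ≥ 2`) with `N ≤ ρ₁ L³` particles, raising the walls from `0` to
any height `λ ≥ 0` does not increase the upper ground-state constant-mode occupation: `n₀⁺(λ,0) ≤ n₀⁺(0,0)`.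
In the lead's skeleton v2 this is DERIVED from `RewardWallGerm` and `MaxwellDanskin` (`wallsOnlyDeplete_of_germ`).
Stub statement — deliberately untagged. -/
def WallsOnlyDeplete : Prop :=
  ∀ v : ℝ → ℝ≥0∞, IsRepulsiveFiniteRange v → ∀ w : ℝ, 0 < w → w < 1 →
    ∃ b₁ : ℝ, 0 < b₁ ∧ ∃ ρ₁ : ℝ, 0 < ρ₁ ∧
      ∀ M : ℕ, 2 ≤ M → ∀ L : ℝ, b₁ * M ≤ L → ∀ N : ℕ, (N : ℝ) ≤ ρ₁ * L ^ 3 →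
        ∀ lam : ℝ, 0 ≤ lam →
          upperCondensate v N L M w lam 0 ≤ upperCondensate v N L M w 0 0

/-- **S2 — the deep-wall band (fixed-`N` strong-confinement limit).** For every admissible `v` and `w ∈ (0,1)` there
is a thick-wall threshold `b₀` (`> 2R₀(v)/w`) such that for `M ≥ 2`, `L ≥ b₀ M`, `1 ≤ N ≤ M³` and EVERY normalised
sector-`N` ground vector `ψ` of `xyTorus 3 M 1`:
`ofReal(z_w · cohSum(ψ)/M³) ≤ liminf_{λ→∞} n₀⁺(λ,0)`. Why plausibly true: thick walls (`s = wL/M > 2R₀(v)`) make every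
inter-well effect of `Σv^{per}` negligible against the tunnelling `t_λ ≍ e^{-√λ s}`; the one-body problem separates into
three rectangular-barrier Kronig–Penney problems (lowest Bloch function → periodised Dirichlet sine, `|⟨φ₀,u₀^λ⟩|² → z_w`);
at fixed `(N, M)` a finite-rank Feshbach–Schur reduction with the in-well pair cost fixed against `t_λ → 0` gives
`H_eff = Nε₀(λ) + t_λ·(H_XY + o(1))` on hard-core configurations, whose sector ground state is unique (Perron), so the
band amplitude of any asymptotic ground state converges to `ψ` and its `n₀` to `z_w·cohSum(ψ)/M³`. In print only for
two wells (Rougerie–Spehner 2018) and one body (Helffer–Sjöstrand 1984). Size L–XL. Stub statement — deliberately untagged. -/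
def DeepWallBand : Prop :=
  ∀ v : ℝ → ℝ≥0∞, IsRepulsiveFiniteRange v → ∀ w : ℝ, 0 < w → w < 1 →
    ∃ b₀ : ℝ, 0 < b₀ ∧
      ∀ (M : ℕ) [NeZero M], 2 ≤ M → ∀ L : ℝ, b₀ * M ≤ L → ∀ N : ℕ, 1 ≤ N → N ≤ M ^ 3 →
        ∀ ψ : TensorIndex (TorusSite 3 M) 2 → ℂ, IsSectorGround M N ψ →
          ENNReal.ofReal (deepShare w / (M : ℝ) ^ 3 * cohSum ψ N) ≤
            Filter.liminf (fun lam : ℝ => upperCondensate v N L M w lam 0) Filter.atTop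

/-- **S3 — lattice readout (finite-dimensional; provable now from two supports of the route, taken BY NAME).**
Given sector Perron–Frobenius (`SectorGroundStatePerron`, stmt-9677) and the penalty encoding
(`PenaltySelectsSector`, stmt-9678): for `M ≥ 2` and `1 ≤ N ≤ M³` there is a normalised sector-`N` ground vector
`ψ` of `xyTorus 3 M 1` with `latticeBracket M N ≤ cohSum ψ N` (in fact equality: the penalised ground space is
`ℂψ`, the tracial functional is `⟨ψ, · ψ⟩`, and `(Sˣ)²+(Sʸ)² = S⁺S⁻ - Sᶻ` with `Sᶻ_tot = N - M³/2` on the sector;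
tree: `LatticeCoherence.groundState_penalised`, `LatticeCoherence.re_inner_planar_add`, `LatticeCoherence.lower_mulVec_apply`).
Size M. Stub statement — deliberately untagged. -/
def LatticeReadout : Prop :=
  SectorGroundStatePerron → PenaltySelectsSector →
    ∀ (M : ℕ) [NeZero M], 2 ≤ M → ∀ N : ℕ, 1 ≤ N → N ≤ M ^ 3 →
      ∃ ψ : TensorIndex (TorusSite 3 M) 2 → ℂ, IsSectorGround M N ψ ∧ latticeBracket M N ≤ cohSum ψ N

/-- **S4 (body) — rigidity of the constant-mode occupation at the wall-free end (`λ = κ = 0`).** For every admissible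
`v` there is `ρ₂ > 0` such that for `0 < ρ < ρ₂`, every `ε > 0`, eventually in `N`, some window `δ > 0` makes the
constant-mode occupations of any two `δ`-near-minimisers of the periodic energy on the torus of side `L_N` agree up
to `εN`. In the lead's skeleton v2 the registered stub is `Sig.stub_freeEndRigidity := PeriodicRigidity → FreeEndRigidity`
(stmt-9467 by name: near-minimisers are `L²`-close modulo a unit phase; then the `L²`-Lipschitz bound of `n₀` on the unit
ball, LSSY 2005 App. A (A.11)/(A.13), landed as `CoarseCellLorentzian.PositiveTransfer.condensateOccupation_le_add_of_unit_mul_lintegral_le`).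
Stub statement — deliberately untagged. -/
def FreeEndRigidity : Prop :=
  ∀ v : ℝ → ℝ≥0∞, IsRepulsiveFiniteRange v →
    ∃ ρ₂ : ℝ, 0 < ρ₂ ∧ ∀ ρ : ℝ, 0 < ρ → ρ < ρ₂ → ∀ ε : ℝ, 0 < ε →
      ∀ᶠ N : ℕ in Filter.atTop, ∃ δ : ℝ≥0∞, 0 < δ ∧
        ∀ Ψ Φ : PeriodicTrialState N (sideLength ρ N),
          periodicEnergy v Ψ ≤ periodicGroundStateEnergy v N (sideLength ρ N) + δ →
          periodicEnergy v Φ ≤ periodicGroundStateEnergy v N (sideLength ρ N) + δ →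
            condensateOccupation N (sideLength ρ N) Ψ.ψ ≤
              condensateOccupation N (sideLength ρ N) Φ.ψ + ENNReal.ofReal (ε * N)

/-- **S1a — the Maxwell/supermodularity GERM at the reward-free edge, with `o(κ)` slack** (the open SIGN in its energy
form): for `0 ≤ λ₁ ≤ λ₂` and `ε > 0` there is `κ₀ > 0` with `E(λ₂,0) + E(λ₁,κ) ≤ E(λ₂,κ) + E(λ₁,0) + εκ` for
`0 ≤ κ ≤ κ₀` ("an infinitesimal condensate reward pushes particles onto the walls": `∂_κ⟨W⟩ ≥ 0 ⟺ ∂_λ n₀ ≤ 0`).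
Typed geometry as in S1 (thick walls `L ≥ b₁M`, low density `N ≤ ρ₁L³`). Sufficient: supermodularity of the jointly
concave `E(λ,κ)` on a strip `0 ≤ κ ≤ κ₀` (ideator ED j008682: 1953/1953 minors `> 0`), or `Cov_path(∫n̂₀, ∫W) ≥ 0` in the
positive imaginary-time measure. Honest difficulty: a sign in the regime `L ≫ ξ`; no correlation-inequality tool in
print. Size XL (open). Stub statement — deliberately untagged. -/
def RewardWallGerm : Prop :=
  ∀ v : ℝ → ℝ≥0∞, IsRepulsiveFiniteRange v → ∀ w : ℝ, 0 < w → w < 1 →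
    ∃ b₁ : ℝ, 0 < b₁ ∧ ∃ ρ₁ : ℝ, 0 < ρ₁ ∧
      ∀ M : ℕ, 2 ≤ M → ∀ L : ℝ, b₁ * M ≤ L → ∀ N : ℕ, (N : ℝ) ≤ ρ₁ * L ^ 3 →
        ∀ lam₁ lam₂ : ℝ, 0 ≤ lam₁ → lam₁ ≤ lam₂ → ∀ ε : ℝ, 0 < ε → ∃ κ₀ : ℝ, 0 < κ₀ ∧
          ∀ kap : ℝ, 0 ≤ kap → kap ≤ κ₀ →
            twoCouplingEnergy v N L M w lam₂ 0 + twoCouplingEnergy v N L M w lam₁ kap ≤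
              twoCouplingEnergy v N L M w lam₂ kap + twoCouplingEnergy v N L M w lam₁ 0 + ENNReal.ofReal (ε * kap)

/-- **S1b — DANSKIN ⇒ MAXWELL** (provable now): at fixed `(v, N, L, M, w)` and `0 ≤ λ₁ ≤ λ₂`, the germ inequality (for
every `ε`, on some `[0, κ₀(ε)]`) implies `n₀⁺(λ₂,0) ≤ n₀⁺(λ₁,0)`. Proof route (two Danskin inequalities in `ℝ≥0∞`): if
`n₀⁺(λ₁,0) < a' < b < n₀⁺(λ₂,0)` (reals, since `n₀ ≤ N`), then (upper, at `λ₂`) every `δ > 0` has a `δ`-near-minimiser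
`Ψ` of `F(λ₂,0,·)` with `n₀Ψ > b`, so `E(λ₂,κ) ≤ E(λ₂,0) + κ(N - b)`; (lower, at `λ₁`) some `η > 0` has
`⨆{n₀Φ : Φ η-near-min} < a'`, so `E(λ₁,κ) ≥ E(λ₁,0) + min(η, κ(N - a'))`; with the germ at `ε = (b - a')/2` and
`0 < κ ≤ min(κ₀, η/(N+1))` this gives `κ(N - a') ≤ κ(N - b) + εκ` (energies finite: `E(λ,0) < ⊤` iff some trial state has
finite periodic energy, independently of `λ`, as `⟨W⟩ ≤ 3N`), i.e. `b - a' ≤ ε`, absurd; and if `E ≡ ⊤` both sides are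
`⨆_Ψ n₀Ψ`. Junk-robust (`L ≤ 0`: `0 ≤ 0`). Size M–L. Stub statement — deliberately untagged. -/
def MaxwellDanskin : Prop :=
  ∀ (v : ℝ → ℝ≥0∞) (N : ℕ) (L : ℝ) (M : ℕ) (w lam₁ lam₂ : ℝ), 0 ≤ lam₁ → lam₁ ≤ lam₂ →
    (∀ ε : ℝ, 0 < ε → ∃ κ₀ : ℝ, 0 < κ₀ ∧ ∀ kap : ℝ, 0 ≤ kap → kap ≤ κ₀ →
      twoCouplingEnergy v N L M w lam₂ 0 + twoCouplingEnergy v N L M w lam₁ kap ≤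
        twoCouplingEnergy v N L M w lam₂ kap + twoCouplingEnergy v N L M w lam₁ 0 + ENNReal.ofReal (ε * kap)) →
    upperCondensate v N L M w lam₂ 0 ≤ upperCondensate v N L M w lam₁ 0

/-! ## Registered stub signatures of the lead's skeleton v2 (`Sig.stub_<name>`; five stubs) -/

/-- Registered signature of `stub_rewardWallGerm` (S1a, HARDEST, open): the statement `RewardWallGerm`.
Stub statement — deliberately untagged. -/
abbrev Sig.stub_rewardWallGerm : Prop := RewardWallGerm

/-- Registered signature of `stub_maxwellDanskin` (S1b, provable now): the statement `MaxwellDanskin`.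
Stub statement — deliberately untagged. -/
abbrev Sig.stub_maxwellDanskin : Prop := MaxwellDanskin

/-- Registered signature of `stub_deepWallBand` (S2, L–XL): the statement `DeepWallBand`.
Stub statement — deliberately untagged. -/
abbrev Sig.stub_deepWallBand : Prop := DeepWallBand

/-- Registered signature of `stub_latticeReadout` (S3, provable now): the statement `LatticeReadout`.
Stub statement — deliberately untagged. -/
abbrev Sig.stub_latticeReadout : Prop := LatticeReadout

/-- Registered signature of `stub_freeEndRigidity` (S4, RESHAPED by the lead: the fixed-`N` route item `PeriodicRigidity`,
stmt-AtomisticToContinuum-9467, namespace `BECLiebAntibunching`, is taken BY NAME as antecedent; provable now from it).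
Stub statement — deliberately untagged. -/
abbrev Sig.stub_freeEndRigidity : Prop := BECLiebAntibunching.PeriodicRigidity → FreeEndRigidity

/-! ## Proved sanity lemmas and glue -/

/-- The wall count is at most `3N` (three axes per particle). [folklore] -/
theorem wallCount_le {N : ℕ} (M : ℕ) (L w : ℝ) (X : Config N) : wallCount M L w X ≤ 3 * (N : ℝ≥0∞) := by
  unfold wallCount
  calc ∑ i : Fin N, ∑ k : Fin 3, (if Int.fract ((M : ℝ) * X i k / L) < w then (1 : ℝ≥0∞) else 0)
      ≤ ∑ _i : Fin N, ∑ _k : Fin 3, (1 : ℝ≥0∞) := by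
        gcongr with i _ k _
        split_ifs <;> simp
    _ = 3 * (N : ℝ≥0∞) := by simp [mul_comm]

/-- The wall energy of a periodic trial state is at most `3N` (normalisation on the cell). [folklore] -/
theorem wallEnergy_le {N : ℕ} {L : ℝ} (M : ℕ) (w : ℝ) (Ψ : PeriodicTrialState N L) :
    wallEnergy N L M w Ψ.ψ ≤ 3 * (N : ℝ≥0∞) := by
  unfold wallEnergy
  calc ∫⁻ X in cellN N L, wallCount M L w X * ((‖Ψ.ψ X‖₊ : ℝ≥0∞)) ^ 2
      ≤ ∫⁻ X in cellN N L, 3 * (N : ℝ≥0∞) * ((‖Ψ.ψ X‖₊ : ℝ≥0∞)) ^ 2 :=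
        lintegral_mono fun X => by gcongr; exact wallCount_le M L w X
    _ = 3 * (N : ℝ≥0∞) * ∫⁻ X in cellN N L, ((‖Ψ.ψ X‖₊ : ℝ≥0∞)) ^ 2 := by
        rw [lintegral_const_mul' _ _ (by simp [ENNReal.mul_eq_top])]
    _ = 3 * (N : ℝ≥0∞) := by rw [Ψ.norm_eq, mul_one]

/-- The wall energy of a periodic trial state is finite. [folklore] -/
theorem wallEnergy_lt_top {N : ℕ} {L : ℝ} (M : ℕ) (w : ℝ) (Ψ : PeriodicTrialState N L) :
    wallEnergy N L M w Ψ.ψ < ⊤ :=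
  (wallEnergy_le M w Ψ).trans_lt (by simp [ENNReal.mul_lt_top])

/-- At `λ = κ = 0` the two-coupling functional is the periodic energy. [folklore] -/
theorem twoCouplingFunctional_zero_zero {N : ℕ} {L : ℝ} (v : ℝ → ℝ≥0∞) (M : ℕ) (w : ℝ)
    (Ψ : PeriodicTrialState N L) : twoCouplingFunctional v M w 0 0 Ψ = periodicEnergy v Ψ := by
  simp [twoCouplingFunctional]

/-- At `λ = κ = 0` the two-coupling energy is the periodic ground-state energy. [folklore] -/
theorem twoCouplingEnergy_zero_zero (v : ℝ → ℝ≥0∞) (N : ℕ) (L : ℝ) (M : ℕ) (w : ℝ) :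
    twoCouplingEnergy v N L M w 0 0 = periodicGroundStateEnergy v N L := by
  unfold twoCouplingEnergy periodicGroundStateEnergy
  exact iInf_congr fun Ψ => twoCouplingFunctional_zero_zero v M w Ψ

/-- At `κ = 0` the two-coupling functional is the periodic energy plus `λ` times the wall energy. [folklore] -/
theorem twoCouplingFunctional_kap_zero {N : ℕ} {L : ℝ} (v : ℝ → ℝ≥0∞) (M : ℕ) (w lam : ℝ)
    (Ψ : PeriodicTrialState N L) :
    twoCouplingFunctional v M w lam 0 Ψ = periodicEnergy v Ψ + ENNReal.ofReal lam * wallEnergy N L M w Ψ.ψ := by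
  simp [twoCouplingFunctional]

/-- **Glue of the S1 split**: Danskin (S1b) turns the germ (S1a) at `λ₁ = 0`, `λ₂ = λ` into LDM₀ for the upper
occupation, `n₀⁺(λ,0) ≤ n₀⁺(0,0)` — the planner's S1 `WallsOnlyDeplete`, with the same thresholds `b₁, ρ₁`. [folklore] -/
theorem wallsOnlyDeplete_of_germ (hD : MaxwellDanskin) (hG : RewardWallGerm) : WallsOnlyDeplete := by
  intro v hv w hw0 hw1
  obtain ⟨b₁, hb₁, ρ₁, hρ₁, h⟩ := hG v hv w hw0 hw1
  refine ⟨b₁, hb₁, ρ₁, hρ₁, fun M hM L hL N hN lam hlam => ?_⟩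
  exact hD v N L M w 0 lam le_rfl hlam (h M hM L hL N hN 0 lam le_rfl hlam)

/-! ## Lead's weakening of the open stub (appended 2026-08-16, skeleton v2): the DEEP-WALL germ

The composition `LatticeToPeriodicBridge_of` consumes LDM₀ only to conclude
`liminf_{λ→∞} n₀⁺(λ,0) ≤ n₀⁺(0,0)`, for which it suffices that the comparison holds EVENTUALLY in `λ` ("sufficiently deep
walls only deplete", Disproof §6(β) `liminf_c Λ(c) ≤ Λ(0)`). The registered open stub of skeleton v2 is therefore the germ
at `λ₁ = 0`, eventually in `λ₂` (`DeepWallGerm`) — strictly weaker than the planner's tool `RewardWallGerm` (all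
`0 ≤ λ₁ ≤ λ₂`, i.e. full monotonicity; `deepWallGerm_of_rewardWallGerm`) and free of the small-`λ` regime, where for
interacting `N ≥ 2` the sign is a competition of two second-order responses (share loss vs. depletion change) that no stub
of this line needs. -/

/-- **S1a — the DEEP-WALL GERM** (the registered open SIGN of skeleton v2, in energy form): for every admissible `v` and
`w ∈ (0,1)` there are `b₁, ρ₁ > 0` such that in the typed geometry (`M ≥ 2`, `L ≥ b₁M`, `N ≤ ρ₁L³`), EVENTUALLY in the
wall height `λ`, the `κ = 0⁺` germ of supermodularity of `E` on the rectangle `{0, λ} × [0, κ₀]` holds with `o(κ)` slack: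
`∀ ε > 0 ∃ κ₀ > 0 ∀ κ ∈ [0, κ₀], E(λ,0) + E(0,κ) ≤ E(λ,κ) + E(0,0) + εκ` ("in a deep enough muffin tin an infinitesimal
condensate reward pushes particles onto the walls at least as much as in free space"). By `MaxwellDanskin` it is
equivalent to `n₀⁺(λ,0) ≤ n₀⁺(0,0)` eventually in `λ` (`deepWallsDeplete_of_germ`). Why plausibly true: everything said
for `RewardWallGerm`/`WallsOnlyDeplete`, now needed only where the deep end has the structural slack `z_w ≪ 1`
(`n₀⁺(λ,0) → z_w·(lattice n₀) ≤ 0.07N` at `w = ½` against `n₀⁺(0,0)`). Honest difficulty: unchanged in kind (a comparison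
of two many-body ground states, `L ≫ ξ`); this IS the crux's open content on this line. Size XL (open).
Stub statement — deliberately untagged. -/
def DeepWallGerm : Prop :=
  ∀ v : ℝ → ℝ≥0∞, IsRepulsiveFiniteRange v → ∀ w : ℝ, 0 < w → w < 1 →
    ∃ b₁ : ℝ, 0 < b₁ ∧ ∃ ρ₁ : ℝ, 0 < ρ₁ ∧
      ∀ M : ℕ, 2 ≤ M → ∀ L : ℝ, b₁ * M ≤ L → ∀ N : ℕ, (N : ℝ) ≤ ρ₁ * L ^ 3 →
        ∀ᶠ lam : ℝ in atTop, ∀ ε : ℝ, 0 < ε → ∃ κ₀ : ℝ, 0 < κ₀ ∧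
          ∀ kap : ℝ, 0 ≤ kap → kap ≤ κ₀ →
            twoCouplingEnergy v N L M w lam 0 + twoCouplingEnergy v N L M w 0 kap ≤
              twoCouplingEnergy v N L M w lam kap + twoCouplingEnergy v N L M w 0 0 + ENNReal.ofReal (ε * kap)

/-- **Deep LDM₀ (occupation form)**: in the typed geometry, EVENTUALLY in `λ`, `n₀⁺(λ,0) ≤ n₀⁺(0,0)` — all of LDM₀ that
`LatticeToPeriodicBridge_of` consumes (`liminf ≤` via `Filter.liminf_le_of_frequently_le'`). Stub statement — deliberately untagged. -/
def DeepWallsDeplete : Prop :=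
  ∀ v : ℝ → ℝ≥0∞, IsRepulsiveFiniteRange v → ∀ w : ℝ, 0 < w → w < 1 →
    ∃ b₁ : ℝ, 0 < b₁ ∧ ∃ ρ₁ : ℝ, 0 < ρ₁ ∧
      ∀ M : ℕ, 2 ≤ M → ∀ L : ℝ, b₁ * M ≤ L → ∀ N : ℕ, (N : ℝ) ≤ ρ₁ * L ^ 3 →
        ∀ᶠ lam : ℝ in atTop, upperCondensate v N L M w lam 0 ≤ upperCondensate v N L M w 0 0

/-- Registered signature of `stub_deepWallGerm` (S1a of skeleton v2, HARDEST, open): the statement `DeepWallGerm`.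
Stub statement — deliberately untagged. -/
abbrev Sig.stub_deepWallGerm : Prop := DeepWallGerm

/-- The planner's tool `RewardWallGerm` (all `0 ≤ λ₁ ≤ λ₂`) implies the registered deep germ (take `λ₁ = 0`). [folklore] -/
theorem deepWallGerm_of_rewardWallGerm (hG : RewardWallGerm) : DeepWallGerm := by
  intro v hv w hw0 hw1
  obtain ⟨b₁, hb₁, ρ₁, hρ₁, h⟩ := hG v hv w hw0 hw1
  refine ⟨b₁, hb₁, ρ₁, hρ₁, fun M hM L hL N hN => ?_⟩
  filter_upwards [eventually_ge_atTop (0 : ℝ)] with lam hlam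
  exact h M hM L hL N hN 0 lam le_rfl hlam

/-- The planner's S1 `WallsOnlyDeplete` (all `λ ≥ 0`) implies the deep occupation form. [folklore] -/
theorem deepWallsDeplete_of_wallsOnlyDeplete (h1 : WallsOnlyDeplete) : DeepWallsDeplete := by
  intro v hv w hw0 hw1
  obtain ⟨b₁, hb₁, ρ₁, hρ₁, h⟩ := h1 v hv w hw0 hw1
  refine ⟨b₁, hb₁, ρ₁, hρ₁, fun M hM L hL N hN => ?_⟩
  filter_upwards [eventually_ge_atTop (0 : ℝ)] with lam hlam
  exact h M hM L hL N hN lam hlam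

/-- **Glue of the S1 split, deep form**: Danskin (S1b) turns the deep germ (S1a) into deep LDM₀ for the upper occupation,
`n₀⁺(λ,0) ≤ n₀⁺(0,0)` eventually in `λ`, with the same thresholds `b₁, ρ₁`. [folklore] -/
theorem deepWallsDeplete_of_germ (hD : MaxwellDanskin) (hG : DeepWallGerm) : DeepWallsDeplete := by
  intro v hv w hw0 hw1
  obtain ⟨b₁, hb₁, ρ₁, hρ₁, h⟩ := hG v hv w hw0 hw1
  refine ⟨b₁, hb₁, ρ₁, hρ₁, fun M hM L hL N hN => ?_⟩
  filter_upwards [h M hM L hL N hN, eventually_ge_atTop (0 : ℝ)] with lam hgerm hlam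
  exact hD v N L M w 0 lam le_rfl hlam hgerm

end Summit.AtomisticToContinuum.BoseEinsteinCondensation.Cruxes.LatticeToPeriodicBridge.MuffinTinRewardSupermodularity

end
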